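import Literature.Computability.AlgebraicComplexity.GroupTheoreticMatMulProofs

/-!
# ω-census, family (b′): the certificate → theorem lane for explicit abelian STPP configurations

HONEST FRAMING (pub-omega census; verbatim): lottery ticket; floor = certified bounds/negative ranges.
Census bookkeeping, not progress on `ω` (the tree proves `ω < 2.373`; every bound obtainable from the
configurations this lane is meant for is `> 2.4`).

The tree proves the fundamental inequality of the group-theoretic approach in the abelian case
(`CohnKleinbergSzegedyUmans2005_5_5_abelian_holds`, CKSU 2005 Thm. 5.5 = BCCGNSU 2017 (1.1)):
an STPP configuration `(A i, B i, C i)_{i<N}` in a finite abelian group `H` (tree predicate `IsSTPP`,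
decidable on explicit `Finset`s) satisfies `Σᵢ (|A i| |B i| |C i|)^{ω/3} ≤ |H|`.  This file turns that
inequality into KERNEL ROWS of the shape «configuration certified ⇒ ω ≤ a/b» for ARBITRARY (non-uniform)
configurations, the analogue of `omega_le_div_of_isLocalStrongUSP` (sub-family (b1-S), uniform volumes):

* `omega_le_div_of_isSTPP` — general certificate: naturals `a, b, D > 0` and per-triple natural witnesses
  `q i` with `(q i)^{3b} ≤ D^{3b} · Vᵢ^a` (i.e. `q i / D ≤ Vᵢ^{a/(3b)}`, `Vᵢ = |A i| |B i| |C i|`) and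
  `D · |H| < Σᵢ q i` give `ω ≤ a/b`.  All hypotheses except `IsSTPP` are integer inequalities (`decide` /
  `norm_num`); `IsSTPP` on explicit finsets is `decide`.
* `omega_le_div_of_isSTPP_uniform` — the equal-volume case: `N` triples of common volume `V > 1` and
  `|H|^{3b} ≤ N^{3b} · V^a` give `ω ≤ a/b`.
Worked instances (explicit configurations with `IsSTPP` certified in the kernel) are added in separate files as
the STPP-track census produces them; the uniform Prop. 5.2 family at its optimum `n = 16` is already the kernel row
`omega_le_of_localSUSP_w3_s2 : ω ≤ 2.816` (via CKSU Thm. 33).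

References: H. Cohn, R. Kleinberg, B. Szegedy, C. Umans, FOCS 2005 (arXiv:math/0511460), Def. 5.1, Prop. 5.2,
Thm. 5.5; J. Blasiak et al., Discrete Analysis 2017:3, (1.1).
-/

noncomputable section

open Literature.Computability.AlgebraicComplexity Finset

namespace Summit.MatrixMultiplication.OmegaCensus

/-- **Certificate → theorem, general form.** Let `(A i, B i, C i)_{i<N}` be an STPP configuration in a finite
abelian group `H` (CKSU 2005 Def. 5.1, tree `IsSTPP`), `Vᵢ = |A i| |B i| |C i|`.  If naturals `a, b, D > 0` and
witnesses `q i` satisfy `(q i)^{3b} ≤ D^{3b} Vᵢ^a` for every `i` and `D |H| < Σᵢ q i`, then `ω ≤ a/b`.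
(Were `ω > a/b`, then `q i / D ≤ Vᵢ^{a/(3b)} ≤ Vᵢ^{ω/3}`, so `Σ q i ≤ D Σ Vᵢ^{ω/3} ≤ D |H|` by CKSU Thm. 5.5,
contradiction.) [cite: CohnKleinbergSzegedyUmans2005, Thm. 5.5 and Def. 5.1] -/
theorem omega_le_div_of_isSTPP {H : Type} [AddCommGroup H] [Fintype H] {N : ℕ}
    {A B C : Fin N → Finset H} (hS : IsSTPP A B C) {a b D : ℕ} (ha : 0 < a) (hb : 0 < b) (hD : 0 < D)
    (q : Fin N → ℕ)
    (hq : ∀ i, q i ^ (3 * b) ≤ D ^ (3 * b) * ((A i).card * (B i).card * (C i).card) ^ a)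
    (hsum : D * Fintype.card H < ∑ i, q i) :
    omega ℂ ≤ (a : ℝ) / (b : ℝ) := by
  by_contra hlt
  rw [not_le] at hlt
  have h55 := CohnKleinbergSzegedyUmans2005_5_5_abelian_holds H N A B C hS
  have hb' : (0 : ℝ) < (b : ℝ) := by exact_mod_cast hb
  have hD' : (0 : ℝ) < (D : ℝ) := by exact_mod_cast hD
  have ha' : (0 : ℝ) < (a : ℝ) := by exact_mod_cast ha
  have h3b : (0 : ℝ) < 3 * (b : ℝ) := by positivity
  have hω2 : (2 : ℝ) ≤ omega ℂ := omega_two_le ℂ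
  have hexp : (a : ℝ) / (3 * (b : ℝ)) ≤ omega ℂ / 3 := by
    rw [div_le_div_iff₀ h3b (by norm_num : (0 : ℝ) < 3)]
    have h1 : (a : ℝ) < omega ℂ * (b : ℝ) := (div_lt_iff₀ hb').1 hlt
    nlinarith
  have hterm : ∀ i, ((q i : ℕ) : ℝ) / (D : ℝ) ≤
      ((((A i).card * (B i).card * (C i).card : ℕ)) : ℝ) ^ (omega ℂ / 3) := by
    intro i
    set V : ℕ := (A i).card * (B i).card * (C i).card with hV
    have hqi := hq i
    have hq0 : (0 : ℝ) ≤ ((q i : ℕ) : ℝ) / (D : ℝ) := by positivity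
    have hV0 : (0 : ℝ) ≤ (V : ℝ) := by positivity
    -- real form of the integer certificate
    have hr : (((q i : ℕ) : ℝ) / (D : ℝ)) ^ (3 * b) ≤ (V : ℝ) ^ a := by
      rw [div_pow, div_le_iff₀ (pow_pos hD' _)]
      have : ((q i ^ (3 * b) : ℕ) : ℝ) ≤ ((D ^ (3 * b) * V ^ a : ℕ) : ℝ) := by exact_mod_cast hqi
      push_cast at this
      linarith
    -- take (3b)-th roots
    have step1 : ((q i : ℕ) : ℝ) / (D : ℝ) ≤ (V : ℝ) ^ ((a : ℝ) / (3 * (b : ℝ))) := by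
      have hn : (3 * b : ℕ) ≠ 0 := by omega
      have e1 : ((((q i : ℕ) : ℝ) / (D : ℝ)) ^ (3 * b)) ^ ((3 * b : ℕ) : ℝ)⁻¹ =
          ((q i : ℕ) : ℝ) / (D : ℝ) := Real.pow_rpow_inv_natCast hq0 hn
      have e2 : ((V : ℝ) ^ a) ^ ((3 * b : ℕ) : ℝ)⁻¹ = (V : ℝ) ^ ((a : ℝ) / (3 * (b : ℝ))) := by
        rw [← Real.rpow_natCast, ← Real.rpow_mul hV0]
        congr 1
        push_cast
        rw [div_eq_mul_inv]
      rw [← e1, ← e2]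
      exact Real.rpow_le_rpow (pow_nonneg hq0 _) hr (by positivity)
    -- monotonicity in the exponent (base ≥ 1), or both sides vanish (base = 0)
    have step2 : (V : ℝ) ^ ((a : ℝ) / (3 * (b : ℝ))) ≤ (V : ℝ) ^ (omega ℂ / 3) := by
      rcases Nat.eq_zero_or_pos V with hz | hpos
      · have hne1 : (a : ℝ) / (3 * (b : ℝ)) ≠ 0 := ne_of_gt (by positivity)
        have hne2 : omega ℂ / 3 ≠ 0 := ne_of_gt (by linarith)
        rw [hz, Nat.cast_zero, Real.zero_rpow hne1, Real.zero_rpow hne2]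
      · exact Real.rpow_le_rpow_of_exponent_le (by exact_mod_cast hpos) hexp
    exact step1.trans step2
  have hsum' : ((D * Fintype.card H : ℕ) : ℝ) < ((∑ i, q i : ℕ) : ℝ) := by exact_mod_cast hsum
  have hle : (∑ i, ((q i : ℕ) : ℝ)) / (D : ℝ) ≤ (Fintype.card H : ℝ) := by
    rw [Finset.sum_div]
    exact (Finset.sum_le_sum fun i _ => hterm i).trans h55
  rw [div_le_iff₀ hD'] at hle
  push_cast at hsum'
  linarith

/-- **Certificate → theorem, uniform volumes.** If the `N` triples of an abelian STPP configuration all have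
the same volume `V = |A i| |B i| |C i| > 1` and `|H|^{3b} ≤ N^{3b} · V^a` with `b > 0`, then `ω ≤ a/b`.
(CKSU Thm. 5.5 gives `N · V^{ω/3} ≤ |H|`; were `ω > a/b`, strict monotonicity of `t ↦ V^t` for `V > 1` would
give `N V^{a/(3b)} < |H|`, contradicting the hypothesis after raising to the power `3b`.)
[cite: CohnKleinbergSzegedyUmans2005, Thm. 5.5 and Def. 5.1] -/
theorem omega_le_div_of_isSTPP_uniform {H : Type} [AddCommGroup H] [Fintype H] {N : ℕ}
    {A B C : Fin N → Finset H} (hS : IsSTPP A B C) {V : ℕ}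
    (hV : ∀ i, (A i).card * (B i).card * (C i).card = V) (h1 : 1 < V) {a b : ℕ} (hb : 0 < b)
    (h : Fintype.card H ^ (3 * b) ≤ N ^ (3 * b) * V ^ a) :
    omega ℂ ≤ (a : ℝ) / (b : ℝ) := by
  by_contra hlt
  rw [not_le] at hlt
  have h55 := CohnKleinbergSzegedyUmans2005_5_5_abelian_holds H N A B C hS
  simp_rw [hV] at h55
  rw [Finset.sum_const, Finset.card_univ, Fintype.card_fin, nsmul_eq_mul] at h55
  -- h55 : N * V^(ω/3) ≤ |H|
  have hb' : (0 : ℝ) < (b : ℝ) := by exact_mod_cast hb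
  have h3b : (0 : ℝ) < 3 * (b : ℝ) := by positivity
  have hV1 : (1 : ℝ) < (V : ℝ) := by exact_mod_cast h1
  have hV0 : (0 : ℝ) ≤ (V : ℝ) := by positivity
  have hexp : (a : ℝ) / (3 * (b : ℝ)) < omega ℂ / 3 := by
    rw [div_lt_div_iff₀ h3b (by norm_num : (0 : ℝ) < 3)]
    have : (a : ℝ) < omega ℂ * (b : ℝ) := (div_lt_iff₀ hb').1 hlt
    nlinarith
  have hcardpos : 0 < Fintype.card H := Fintype.card_pos
  have hNpos : 0 < N := by
    rcases Nat.eq_zero_or_pos N with hz | hp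
    · exfalso
      rw [hz, zero_pow (by omega : 3 * b ≠ 0), zero_mul] at h
      have := Nat.pow_pos (n := 3 * b) hcardpos
      omega
    · exact hp
  have hN' : (0 : ℝ) < (N : ℝ) := by exact_mod_cast hNpos
  -- strict: N V^{a/(3b)} < N V^{ω/3} ≤ |H|
  have hstrict : (N : ℝ) * (V : ℝ) ^ ((a : ℝ) / (3 * (b : ℝ))) < (Fintype.card H : ℝ) := by
    have := Real.rpow_lt_rpow_of_exponent_lt hV1 hexp
    nlinarith
  -- raise to the power 3b: (N V^{a/(3b)})^{3b} = N^{3b} V^a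
  have hpow : ((N : ℝ) * (V : ℝ) ^ ((a : ℝ) / (3 * (b : ℝ)))) ^ (3 * b) = (N : ℝ) ^ (3 * b) * (V : ℝ) ^ a := by
    rw [mul_pow, ← Real.rpow_natCast ((V : ℝ) ^ ((a : ℝ) / (3 * (b : ℝ)))), ← Real.rpow_mul hV0]
    have : (a : ℝ) / (3 * (b : ℝ)) * ((3 * b : ℕ) : ℝ) = (a : ℕ) := by
      push_cast
      field_simp
    rw [this, Real.rpow_natCast]
  have hlhs0 : (0 : ℝ) ≤ (N : ℝ) * (V : ℝ) ^ ((a : ℝ) / (3 * (b : ℝ))) := by positivity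
  have hlt' : ((N : ℝ) * (V : ℝ) ^ ((a : ℝ) / (3 * (b : ℝ)))) ^ (3 * b) < (Fintype.card H : ℝ) ^ (3 * b) :=
    pow_lt_pow_left₀ hstrict hlhs0 (by omega)
  rw [hpow] at hlt'
  have hR : ((Fintype.card H ^ (3 * b) : ℕ) : ℝ) ≤ ((N ^ (3 * b) * V ^ a : ℕ) : ℝ) := by exact_mod_cast h
  push_cast at hR
  linarith

end Summit.MatrixMultiplication.OmegaCensus

end
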